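import Summits.Langlands.Langlands.Statement
import Summits.Langlands.Langlands.Theorems.SmithKummerSeedCyclicPrimeAscentBlockDiagonalPick
import Summits.Langlands.Langlands.Theorems.IrreducibilityBySelfDualityIrreducibleOffSectorInductionAscent
import Literature.NumberTheory.GaloisRepresentations.LAdicRepFrobenius
import Literature.NumberTheory.Automorphic.ChebotarevArtinRepHolds
import Literature.NumberTheory.GaloisRepresentations.RestrictFieldSemisimple
import Literature.NumberTheory.GaloisRepresentations.FramedRepEquivConj
import Literature.NumberTheory.GaloisRepresentations.InducedGaloisRep
import Literature.NumberTheory.GaloisRepresentations.InducedAEUnramified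
import Literature.NumberTheory.GaloisRepresentations.FramedRepBlockSum
import Literature.NumberTheory.GaloisRepresentations.AbsGaloisOuterConj
import Literature.NumberTheory.Automorphic.AutomorphicRepsGLSatakeFlathProofs
import Literature.NumberTheory.Automorphic.ReciprocityGLnRestrictionProofs
import Literature.RepresentationTheory.FiniteGroups.VirtualBrauerDescent
import HarnessLib

/-!
# The pick in the Galois-regular case
# (crux `AscentConjugationSolvable`, stmt-Langlands-1094; piece `CyclicPrimeAscent`; lead c3 helper stub H8)

Support file (closes nothing).  The identification step of Arthur–Clozel's Thm. 4.2 (b) of Ch. 3,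
read on the Galois side.  Let `L/K` be a Galois extension of number fields (of prime degree `p`),
`ρ : Γ_L → GL_n(ℚ̄_ℓ)` irreducible, `P` an automorphic representation of `GL_{pn}(𝔸_K)` which is
Satake–Frobenius compatible with `Ind_L^K ρ` almost everywhere, `Pf τ` (`τ ∈ Gal(L/K)`) cuspidal
representations of `GL_n(𝔸_L)`, Galois-conjugate to `Pf 1` on Satake parameters
(`t_{Pf τ, w} = t_{Pf 1, τ w}`) and each automorphically inducing to `P`, and `ρ₁` an irreducible
almost-everywhere avatar of `Pf 1`.  Then `ρ` is an almost-everywhere avatar of some `Pf τ`: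

1. `Ind ρ₁` is a.e. compatible with `P` (`eventually_satakeFrobCompatibleAt_induce_rank`), hence
   (uniqueness of Satake parameters) `Ind ρ₁` and `Ind ρ` are unramified with the same Frobenius
   polynomial at almost every `v`, and so are their restrictions to `Γ_L` at almost every `w`
   (`hasFrobCharpolyAt_restrictField_arithFrobPolyOfSatake`);
2. both restrictions are block-diagonal with irreducible blocks the conjugates `ρ₁^{rᵢ⁻¹}`, resp.
   `ρ^{rᵢ⁻¹}` (`induce_restrictField_apply_coe`), hence SEMISIMPLE, hence EQUIVALENT (Chebotarev +
   Brauer–Nesbitt, `nonempty_equiv_of_hasFrobCharpolyAt_eventually`), hence conjugate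
   (`exists_eq_conj_of_equiv`), and the Jordan–Hölder pick (`blockDiagonal_semisimple_and_pick`) at
   the identity coset gives `ρ ≅ ρ₁^a` for some `a ∈ Γ_K`;
3. `ρ₁^a` is an a.e. avatar of `Pf ā` (`eventually_outerConj_compatible_rank` and the family
   relation), and Satake–Frobenius compatibility is invariant under a change of frame.

References: J. Arthur, L. Clozel, *Simple algebras, base change, and the advanced theory of the
trace formula*, Ann. of Math. Stud. 120 (1989), Ch. 3, Thm. 4.2 (b), (e) and Def. 6.1; J.-P. Serre,
*Linear representations of finite groups* (1977), §7.3 Prop. 22.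
-/

noncomputable section

set_option linter.dupNamespace false -- project-wide option; `Summit.Langlands.Langlands` is the mandated namespace

namespace Summit.Langlands.Langlands.Theorems.SmithKummerSeedCyclicPrimeAscent

open scoped MatrixGroups NumberField Classical Matrix Polynomial
open Filter IsDedekindDomain Field Literature.NumberTheory.Automorphic
  Literature.NumberTheory.GaloisRepresentations Summit.Langlands

/-! ### Two invariances -/

section Conj

variable {K L : Type} [Field K] [Field L] [Algebra K L] [IsGalois K L] [CharZero L]
  {A : Type} [Field A] [TopologicalSpace A] [IsTopologicalRing A] {n : ℕ}

/-- **A conjugate `ρ^τ = ρ ∘ θ_τ` of an irreducible framed Galois representation is irreducible**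
(`θ_τ` is an automorphism of `Γ_L`, so `ρ` and `ρ^τ` have the same stable subspaces).
[cite: SerreLinearRepresentations1977, §7.2] -/
private theorem isIrreducible_outerConj (τ : absoluteGaloisGroup K) (ρ : FramedGaloisRep L A n)
    (h : ρ.toGaloisRep.IsIrreducible) : FramedRep.IsIrreducible (ρ.outerConj τ) := by
  change ((ρ.outerConj τ).toGaloisRep.toRepresentation).IsIrreducible
  rw [FramedGaloisRep.toRepresentation_outerConj]
  exact (Literature.RepresentationTheory.FiniteGroups.Representation.isIrreducible_comp_iff_of_surjective
    _ (absGaloisOuterConj_bijective K L τ).2).2 h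

end Conj

section Frame

variable {K : Type} [Field K] [NumberField K] {n : ℕ} {hcpt : isCompact_glFiniteIntegralLevel n K}
  {ℓ : ℕ} [Fact ℓ.Prime]

-- adapted from `ReciprocityUpToIrreducibility.satakeFrobCompatibleAt_conj` (CorrespondsConj)
/-- Satake–Frobenius compatibility at `v` is invariant under a change of frame `ρ ↦ P ρ P⁻¹`
(unramifiedness and the characteristic polynomial of Frobenius are). [cite: SerreAbelianLadic1968, Ch. I §2.3] -/
private theorem satakeFrobCompatibleAt_conj_iff (ι : PadicAlgCl ℓ ≃+* ℂ)
    (π : AutomorphicRepData (AutomorphyDatum.gl n K hcpt)) (P : GL (Fin n) (PadicAlgCl ℓ))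
    (ρ : FramedGaloisRep K (PadicAlgCl ℓ) n) (v : HeightOneSpectrum (𝓞 K)) :
    SatakeFrobCompatibleAt ι π (FramedRep.conj P ρ) v ↔ SatakeFrobCompatibleAt ι π ρ v := by
  refine exists_congr fun α => and_congr_right fun _ => and_congr
    (FramedGaloisRep.isUnramifiedAt_conj_iff v P ρ)
    (forall₂_congr fun 𝔓 _ => forall₂_congr fun σ _ => ?_)
  rw [IrreducibleOffSector.charpoly_conj P ρ σ]

end Frame

/-! ### The pick -/

/-- HELPER STUB H8 (the lead's) — **the PICK in the Galois-regular case**: `ρ : Γ_L → GL_n(ℚ̄_ℓ)` irreducible,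
Galois-regular, unramified a.e.; `P` on `GL_{pn}(𝔸_K)` a.e. compatible with `Ind_L^K ρ`; `Pf τ` (`τ ∈ Gal(L/K)`)
cuspidal on `GL_n(𝔸_L)`, Galois-conjugate to `Pf 1` on Satake parameters and each automorphically inducing to
`P`; `ρ₁` an irreducible a.e. avatar of `Pf 1`.  Then `ρ` is an a.e. avatar of some `Pf τ`: `Ind ρ₁` and `Ind ρ`
are a.e. compatible with `P` (`eventually_satakeFrobCompatibleAt_induce_rank`, Satake uniqueness), their restrictions
to `Γ_L` are the block-diagonals of the conjugates (`induce_restrictField_apply_coe`), semisimple with equal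
Frobenius polynomials a.e., hence conjugate (Chebotarev + Brauer–Nesbitt), so `ρ ≅ ρ₁^a` for some `a ∈ Γ_K`
(H7), and `ρ₁^a` is the avatar of `Pf ā` (`eventually_outerConj_compatible_rank` + the family relation).
[cite: ArthurClozelAMS120, Ch. 3 Thm. 4.2 (b), (e) and Def. 6.1] [cite: SerreLinearRepresentations1977, §7.3 Prop. 22] -/
theorem pick_of_regular : ∀ (K L : Type) [Field K] [NumberField K] [Field L] [NumberField L] [Algebra K L] [IsGalois K L], (Module.finrank K L).Prime → ∀ (n : ℕ) (ℓ : ℕ) [Fact ℓ.Prime] (ι : PadicAlgCl ℓ ≃+* ℂ) (ρ : Literature.NumberTheory.GaloisRepresentations.FramedGaloisRep L (PadicAlgCl ℓ) n), ρ.toGaloisRep.IsIrreducible → (∀ g : Field.absoluteGaloisGroup K, g ∉ Set.range (Literature.NumberTheory.GaloisRepresentations.absGaloisRestrict K L) → ∀ P : GL (Fin n) (PadicAlgCl ℓ), Literature.NumberTheory.GaloisRepresentations.FramedRep.conj P (ρ.outerConj g) ≠ ρ) → (∀ᶠ w : IsDedekindDomain.HeightOneSpectrum (NumberField.RingOfIntegers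 L) in Filter.cofinite, ρ.IsUnramifiedAt w) → ∀ (hK : Literature.NumberTheory.Automorphic.isCompact_glFiniteIntegralLevel (Module.finrank K L * n) K) (hL : Literature.NumberTheory.Automorphic.isCompact_glFiniteIntegralLevel n L) (P : Literature.NumberTheory.Automorphic.AutomorphicRepData (Literature.NumberTheory.Automorphic.AutomorphyDatum.gl (Module.finrank K L * n) K hK)), (∀ᶠ v : IsDedekindDomain.HeightOneSpectrum (NumberField.RingOfIntegers K) in Filter.cofinite, SatakeFrobCompatibleAt ι P (ρ.induce K (rfl : Module.finrank K L = Module.finrank K L)) v) → ∀ (Pf : (L ≃ₐ[K] L) → Literature.NumberTheory.Automorphic.CuspidalAutomorphicRepData n L hL), (∀ τ : L ≃ₐ[K] L, ∀ᶠ w : IsDedekindDomain.HeightOneSpectrum (NumberField.RingOfIntegers L) in Filter.cofinite, ∀ β : Multiset ℂ, (Pf 1).1.HasSatakeParamAt (τ • w) β → (Pf τ).1.HasSatakeParamAt w β) → (∀ τ : L ≃ₐ[K] L, Literature.NumberTheory.Automorphic.IsAutomorphicInductionAlong (Pf τ).1 P) → ∀ (ρ₁ : Literature.NumberTheory.GaloisRepresentations.FramedGaloisRep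 L (PadicAlgCl ℓ) n), ρ₁.toGaloisRep.IsIrreducible → (∀ᶠ w : IsDedekindDomain.HeightOneSpectrum (NumberField.RingOfIntegers L) in Filter.cofinite, SatakeFrobCompatibleAt ι (Pf 1).1 ρ₁ w) → ∃ τ : L ≃ₐ[K] L, ∀ᶠ w : IsDedekindDomain.HeightOneSpectrum (NumberField.RingOfIntegers L) in Filter.cofinite, SatakeFrobCompatibleAt ι (Pf τ).1 ρ w := by
  intro K L _ _ _ _ _ _ _hp n ℓ _ ι ρ hρirr _hreg _hunr hK hL P hP Pf hfam hAI ρ₁ hρ₁irr hρ₁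
  haveI : FiniteDimensional K L := Module.Finite.of_restrictScalars_finite ℚ K L
  -- (1) `Ind ρ₁` is a.e. compatible with `P`
  have hA := IrreducibleOffSector.eventually_satakeFrobCompatibleAt_induce_rank ι (Pf 1).1 P (hAI 1)
    ρ₁ hρ₁ (rfl : Module.finrank K L = Module.finrank K L) (Equiv.refl _)
  -- `Ind ρ₁`, `Ind ρ` are unramified with a common Frobenius polynomial at almost every `v`
  have hgoodK : ∀ᶠ v : HeightOneSpectrum (𝓞 K) in cofinite,
      (ρ₁.induce K (rfl : Module.finrank K L = Module.finrank K L)).IsUnramifiedAt v ∧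
      (ρ.induce K (rfl : Module.finrank K L = Module.finrank K L)).IsUnramifiedAt v ∧
      ∃ α : Multiset ℂ,
        (ρ₁.induce K (rfl : Module.finrank K L = Module.finrank K L)).HasFrobCharpolyAt v
          (arithFrobPolyOfSatake ι v.residueCard 1 α) ∧
        (ρ.induce K (rfl : Module.finrank K L = Module.finrank K L)).HasFrobCharpolyAt v
          (arithFrobPolyOfSatake ι v.residueCard 1 α) := by
    filter_upwards [hA, hP] with v ⟨α, hα, hAu, hAc⟩ ⟨α', hα', hBu, hBc⟩
    obtain rfl : α' = α := P.hasSatakeParamAt_unique_holds hα' hα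
    exact ⟨(FramedGaloisRep.isUnramifiedAt_reindex_iff v _ _).1 hAu, hBu, _,
      (FramedGaloisRep.hasFrobCharpolyAt_reindex_iff v _ _ _).1 hAc, hBc⟩
  -- and so are their restrictions to `Γ_L` at almost every `w`
  have hgoodL : ∀ᶠ w : HeightOneSpectrum (𝓞 L) in cofinite,
      ((ρ₁.induce K (rfl : Module.finrank K L = Module.finrank K L)).restrictField L).IsUnramifiedAt w ∧
      ((ρ.induce K (rfl : Module.finrank K L = Module.finrank K L)).restrictField L).IsUnramifiedAt w ∧
      ∃ Q : Polynomial (PadicAlgCl ℓ),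
        ((ρ₁.induce K (rfl : Module.finrank K L = Module.finrank K L)).restrictField L).HasFrobCharpolyAt
          w Q ∧
        ((ρ.induce K (rfl : Module.finrank K L = Module.finrank K L)).restrictField L).HasFrobCharpolyAt
          w Q := by
    filter_upwards [eventually_forall_under_eq (E := L) hgoodK] with w hw
    obtain ⟨hAu, hBu, α, hAc, hBc⟩ := hw (w.under (𝓞 K)) rfl
    obtain ⟨h1, h2⟩ := hasFrobCharpolyAt_restrictField_arithFrobPolyOfSatake (L := L)
      (v := w.under (𝓞 K)) ι _ rfl hAu 1 hAc
    obtain ⟨h3, h4⟩ := hasFrobCharpolyAt_restrictField_arithFrobPolyOfSatake (L := L)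
      (v := w.under (𝓞 K)) ι _ rfl hBu 1 hBc
    exact ⟨h1, h3, _, h2, h4⟩
  -- (2) both restrictions are block-diagonal with irreducible blocks: semisimple (H7) …
  have hairr : ∀ i : Fin (Module.finrank K L), FramedRep.IsIrreducible
      (ρ₁.outerConj (absGaloisCosetRep K L (rfl : Module.finrank K L = Module.finrank K L) i)⁻¹) :=
    fun i => isIrreducible_outerConj _ ρ₁ hρ₁irr
  have hbirr : ∀ i : Fin (Module.finrank K L), FramedRep.IsIrreducible
      (ρ.outerConj (absGaloisCosetRep K L (rfl : Module.finrank K L = Module.finrank K L) i)⁻¹) :=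
    fun i => isIrreducible_outerConj _ ρ hρirr
  have h7 := blockDiagonal_semisimple_and_pick (absoluteGaloisGroup L) ℓ (Module.finrank K L) n
    (fun i => ρ₁.outerConj (absGaloisCosetRep K L (rfl : Module.finrank K L = Module.finrank K L) i)⁻¹)
    (fun i => ρ.outerConj (absGaloisCosetRep K L (rfl : Module.finrank K L = Module.finrank K L) i)⁻¹)
    ((ρ₁.induce K (rfl : Module.finrank K L = Module.finrank K L)).restrictField L)
    ((ρ.induce K (rfl : Module.finrank K L = Module.finrank K L)).restrictField L)
    (FramedGaloisRep.induce_restrictField_apply_coe K rfl ρ₁)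
    (FramedGaloisRep.induce_restrictField_apply_coe K rfl ρ) hairr hbirr
  have h7' := blockDiagonal_semisimple_and_pick (absoluteGaloisGroup L) ℓ (Module.finrank K L) n
    (fun i => ρ.outerConj (absGaloisCosetRep K L (rfl : Module.finrank K L = Module.finrank K L) i)⁻¹)
    (fun i => ρ₁.outerConj (absGaloisCosetRep K L (rfl : Module.finrank K L = Module.finrank K L) i)⁻¹)
    ((ρ.induce K (rfl : Module.finrank K L = Module.finrank K L)).restrictField L)
    ((ρ₁.induce K (rfl : Module.finrank K L = Module.finrank K L)).restrictField L)
    (FramedGaloisRep.induce_restrictField_apply_coe K rfl ρ)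
    (FramedGaloisRep.induce_restrictField_apply_coe K rfl ρ₁) hbirr hairr
  -- … hence equivalent (Chebotarev + Brauer–Nesbitt), hence conjugate
  obtain ⟨e⟩ := FramedGaloisRep.nonempty_equiv_of_hasFrobCharpolyAt_eventually
    chebotarev_artinRep_holds _ _ h7.1 h7'.1 hgoodL
  obtain ⟨P₀, hP₀⟩ := FramedRep.exists_eq_conj_of_equiv _ _ e
  -- the identity coset `r_{j₀} ∈ res(Γ_L)` and the pick `ρ^{r_{j₀}⁻¹} = Q ρ₁^{rᵢ⁻¹} Q⁻¹`
  obtain ⟨j₀, hj₀⟩ := (absGaloisCosetRep_bijective K L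
    (rfl : Module.finrank K L = Module.finrank K L)).2
      ((1 : absoluteGaloisGroup K) : absoluteGaloisGroup K ⧸ (absGaloisRestrict K L).range)
  have hj₀' : ((absGaloisCosetRep K L (rfl : Module.finrank K L = Module.finrank K L) j₀ :
      absoluteGaloisGroup K) : absoluteGaloisGroup K ⧸ (absGaloisRestrict K L).range) =
        ((1 : absoluteGaloisGroup K) : absoluteGaloisGroup K ⧸ (absGaloisRestrict K L).range) := hj₀
  obtain ⟨σ₁, hσ₁⟩ : (absGaloisCosetRep K L (rfl : Module.finrank K L = Module.finrank K L) j₀)⁻¹ ∈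
      (absGaloisRestrict K L).range := by
    have hmem := QuotientGroup.eq.1 hj₀'
    rwa [mul_one] at hmem
  have hσ₁' : absGaloisRestrict K L σ₁ =
      (absGaloisCosetRep K L (rfl : Module.finrank K L = Module.finrank K L) j₀)⁻¹ := hσ₁
  obtain ⟨i, Q, hQ⟩ := h7.2 P₀ hP₀ j₀
  have hρconj : FramedRep.conj (ρ σ₁) ρ = FramedRep.conj Q
      (ρ₁.outerConj (absGaloisCosetRep K L (rfl : Module.finrank K L = Module.finrank K L) i)⁻¹) := by
    rw [← FramedGaloisRep.outerConj_absGaloisRestrict (F := K) σ₁ ρ, hσ₁']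
    exact hQ
  -- (3) `ρ₁^a`, `a = rᵢ⁻¹`, is an a.e. avatar of `Pf ā`, and so is its conjugate `ρ`
  refine ⟨absGaloisQuot K L
    (absGaloisCosetRep K L (rfl : Module.finrank K L = Module.finrank K L) i)⁻¹, ?_⟩
  have hinj : Function.Injective fun w : HeightOneSpectrum (𝓞 L) => absGaloisQuot K L
      (absGaloisCosetRep K L (rfl : Module.finrank K L = Module.finrank K L) i)⁻¹ • w :=
    MulAction.injective _
  filter_upwards [IrreducibleOffSector.eventually_outerConj_compatible_rank ι (Pf 1).1 ρ₁ hρ₁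
      (absGaloisCosetRep K L (rfl : Module.finrank K L = Module.finrank K L) i)⁻¹,
    hfam (absGaloisQuot K L (absGaloisCosetRep K L (rfl : Module.finrank K L = Module.finrank K L) i)⁻¹),
    hinj.tendsto_cofinite.eventually hρ₁] with w hw hfw hw₁
  obtain ⟨β, hβ, -, -⟩ := hw₁
  have hψ : SatakeFrobCompatibleAt ι
      (Pf (absGaloisQuot K L (absGaloisCosetRep K L (rfl : Module.finrank K L = Module.finrank K L) i)⁻¹)).1
      (FramedRep.conj Q (ρ₁.outerConj
        (absGaloisCosetRep K L (rfl : Module.finrank K L = Module.finrank K L) i)⁻¹)) w :=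
    (satakeFrobCompatibleAt_conj_iff ι _ Q _ w).2 ⟨β, hfw β hβ, (hw β hβ).1, (hw β hβ).2⟩
  rw [← hρconj] at hψ
  exact (satakeFrobCompatibleAt_conj_iff ι _ (ρ σ₁) ρ w).1 hψ

end Summit.Langlands.Langlands.Theorems.SmithKummerSeedCyclicPrimeAscent
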